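import Literature.AlgebraicGeometry.HodgeTheory.FermatInductiveClaims
import Mathlib.RingTheory.MvPolynomial.Symmetric.NewtonIdentities
import HarnessLib

/-!
# Aoki's `p`-standard cycles: the proved bricks of Thm. 2-1 (represents ⟹ claim; `Y ⊂ X^{p-1}ₘ`)

Family `hodge`, layer `Literature/AlgebraicGeometry/HodgeTheory`. Proof file (bottom-up, D-0026:
everything here is PROVED, no named fact is introduced) for the named fact
`Aoki1987_claim_pStandard` of the sibling file `FermatInductiveClaims` — Aoki, J. Math. Soc. Japan
39 (1987) 385–396, Thm. 2-1 (p. 388) with "represents ⟹ claim" (p. 386) — following the printed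
proof (pp. 386, 389–390; whole paper read 2026-08-15 from the J-STAGE copy):

* `FermatCharacter.claim_of_represents` — **p. 386: "If there exists an algebraic cycle `Z` on
  `Xⁿₘ` such that `ω_α(Z) ≠ 0`, then claim(α) is true"**, on the real carriers: if `V(α)` is at
  most a line (`dim V(α) = 1`, "well known (see [3], [4])", p. 385) and some algebraic class
  `c ∈ algebraicClasses (fermatHypersurface (2r) m) r` has `π_α c ≠ 0` (`ω_α(Z)` is a non-zero
  multiple of `P_α([Z])`, p. 386), then `V(α) ≤ algebraicClasses`: `π_α` preserves algebraic
  classes (tree: `eigenProjector_mem_algebraicClasses`, the Fermat hypersurface being smooth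
  projective, `isSmoothProjective_fermatHypersurface`), so the line `V(α) = ℂ · π_α c` is algebraic.
* `Aoki1987.pStandard_ne_zero`, `Aoki1987.pStandard_sum_eq_zero`, `Aoki1987.isAdmissible_pStandard`
  — **`σ_{p,a} ∈ 𝔄^{p-1}ₘ`**: for `m = pd`, `d > 2`, `(a, d) = 1`, every coordinate of
  `σ ∼ (a, a+d, …, a+(p-1)d, -pa)` is non-zero (`d ∤ a`) and `Σ σᵢ = d·p(p-1)/2 = m r = 0` in
  `ℤ/m` (p. 387: the `p`-standard elements lie in `𝔅^{p-1}ₘ ⊂ 𝔄^{p-1}ₘ`).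
* `Aoki1987.psum_mem_span_esymm`, `Aoki1987.psum_sub_mul_esymm_mem_span_esymm` — **Lemma 3-2 ⇒
  (3.1)–(3.2)** in the form used: in `R[y₀, …, y_{p-1}]`, `p = 2r + 1`, the power sums
  `y₀ᵏ + ⋯ + y_{p-1}ᵏ`, `1 ≤ k ≤ r`, and `y₀ᵖ + ⋯ + y_{p-1}ᵖ - p·y₀⋯y_{p-1}` lie in the ideal
  `(f₁, …, f_r)`, `fᵢ = eᵢ(y)` (Newton's identities, Mathlib `psum_eq_mul_esymm_sub_sum`; Aoki's
  `x₀ᵐ + ⋯ + x_{p-1}ᵐ = f₁g₁ + ⋯ + f_rg_r + p f_p`).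
* `Aoki1987.sum_X_pow_mem_idealY`, `Aoki1987.fermatPolynomial_mem_idealY` — **(3.3) and
  Prop. 3-1 (i): `Y ⊂ X^{p-1}ₘ`** — with `yᵢ = xᵢᵈ` and `f₀ = x_pᵖ - c·x₀x₁⋯x_{p-1}`, `cᵈ = -p`
  (Aoki: `c = εᵖ ᵈ√p`, `ε = exp(π√-1/m)`, so `cᵈ = εᵐ p = -p`; `x_pᵐ + p f_p = ∏_{ζᵈ=1} f_{0,ζ}`),
  the Fermat form `x₀ᵐ + ⋯ + x_pᵐ` (`m = pd`) lies in the homogeneous ideal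
  `(f₀, e₁(xᵈ), …, e_r(xᵈ))` of the equations (2.1) of `Y` (in the equivalent form
  `f₀ = f₁ = ⋯ = f_r = 0` of the proof of Prop. 3-1), over any commutative ring.
* `Aoki1987.isHodge_pStandard` — **`σ_{p,a} ∈ 𝔅^{p-1}ₘ`** (p. 387: "These elements belong to
  … `𝔅^{p-1}ₘ`"): for every unit `t ∈ (ℤ/m)ˣ`, `2 |tσ| = 2r + 2` — the representatives of
  `t(a + kd)`, `k < p`, are a permutation of `b₀, b₀ + d, …, b₀ + (p-1)d` (`⟨ta⟩ ≡ b₀ mod d`,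
  `0 < b₀ < d`) and `⟨-pta⟩ = m - p b₀`, total `m(r+1)`; so the `p`-standard characters may be fed
  to `Aoki1987_claim_juxtaposition` (Thm. 1-4 (i)), which asks for Hodge characters.
* `Aoki1987.zeroLocus_idealY_subset` — Prop. 3-1 (i) on the points of `ℙᵖ_ℂ = Proj ℂ[x₀, …, x_p]`:
  `V₊(f₀, e₁(xᵈ), …, e_r(xᵈ)) ⊆ V₊(x₀ᵐ + ⋯ + x_pᵐ)`, the underlying set of `X^{p-1}ₘ`.
* `Aoki1987_claim_pStandard_of_represents` — **the assembly**: the named fact follows from the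
  two remaining inputs, stated on the tree's carriers exactly as the hypotheses `hE2`/`hE4`/`hB`
  of `FermatHodgeConjectureAssembly`: (I) `hE1`, `dim V(α) ≤ 1` for `α ∈ 𝔄²ʳₘ`, `r > 0`
  (Ran 1980 Prop. 1.7 (i) / "well known", p. 385); (II) `hY`, Thm. 2-1 proper in the form
  "some codimension-`r` algebraic class has `π_σ c ≠ 0`" (`Y` represents `σ`:
  `ω_σ(Y)·\overline{ω_σ(Y)} = (-1)ʳ p^{p-2} mᵖ ≠ 0`, pp. 391–396).

## What is NOT here (the remaining layers of the printed proof, pp. 390–396)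

Prop. 3-1 (ii)–(v) (`G_Y = G₀ ∩ Ker σ`, `deg Y = p·r!·dʳ`, `D₁⋯D_r ∼ Σ_g Y^g ∼ r! dʳ L`),
Lemma 3-3, Prop. 3-4, Cor. 3-5 (the intersection numbers `Y·Y^g`), §4 (Lemma 4-1, 4-2,
Prop. 4-3, Prop. 4-4 — the latter by the Hodge index theorem, Weil, *Variétés kählériennes*
Th. 7 — and the final count): they need the cycle class map `CH^r(X) → H²ʳ(X(ℂ); ℂ)` compatible
with intersection products, its `G`-equivariance, and the Hodge–Riemann bilinear relations on
the primitive middle cohomology, none of which the tree has on its carriers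
(`singularCohomology` of `ComplexPoints`); and input (I), the eigenspace structure of
`Hⁿ(Xⁿₘ(ℂ); ℂ)` (Griffiths residues / Pham), likewise. They enter `Aoki1987_claim_pStandard_of_represents`
as the hypotheses `hY` and `hE1`.

## References

* [Aoki1987] N. Aoki, Some new algebraic cycles on Fermat varieties, J. Math. Soc. Japan 39 (1987)
  385–396, doi:10.2969/jmsj/03930385: p. 385 (`dim V(α) = 1`), p. 386 (`ω_α(Z)`, `P_α`,
  represents ⟹ claim), p. 387 (`σ_{p,i}`), §2 (2.1) and Thm. 2-1 (p. 388), §3 notation and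
  Prop. 3-1 (i), Lemma 3-2, (3.1)–(3.3) (pp. 389–390) (text read, J-STAGE copy).
* [Ran1980] Z. Ran, Cycles on Fermat hypersurfaces, Compositio Math. 42 (1980) 121–142, §1
  Prop. 1.7 (i) (`dim V(α) = 1`).
* [Shioda1979PJA] T. Shioda, The Hodge conjecture and the Tate conjecture for Fermat varieties,
  Proc. Japan Acad. 55A (1979) 111–114, §4 (the projectors `P_α`).
-/

noncomputable section

open Finset

namespace Literature.AlgebraicGeometry.HodgeTheory

open Literature.AlgebraicGeometry.Motives Literature.AlgebraicTopology.SingularHomology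

/-! ### Represents ⟹ claim (Aoki p. 386) -/

/-- **"If there exists an algebraic cycle `Z` on `Xⁿₘ` such that `ω_α(Z) ≠ 0`, then claim(α) is
true"** (Aoki p. 386), on the real carriers. For a character `α` of `X²ʳₘ`: if `V(α)` is at most
a line (`hdim`; `dim V(α) = 1` for `α ∈ 𝔄`, p. 385) and some class `c` in the span of the classes
of codimension-`r` algebraic cycles has a non-zero `α`-component `π_α c` (`hZ`; Aoki's
`ω_α(Z) = (#G/#G_Z) P_α([Z]) ≠ 0`), then `V(α)` consists of algebraic classes: `π_α c` is again
algebraic (`eigenProjector_mem_algebraicClasses`: the `g^*`, `g ∈ μₘ²ʳ⁺²`, are flat pull-backs) and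
spans the line `V(α)`. Dimension `0` (`r = 0`) is trivial: `algebraicClasses _ 0 = ⊤`.
[cite: Aoki1987, p. 386 (ω_α(Z), P_α, "represents")] [cite: Shioda1979PJA, §4] -/
theorem FermatCharacter.claim_of_represents {m r : ℕ} [NeZero m] {α : Fin (2 * r + 2) → ZMod m}
    (hdim : ∃ v, fermatEigenspace m α (2 * r) ≤ ℂ ∙ v)
    (hZ : ∃ c ∈ algebraicClasses (fermatHypersurface (2 * r) m) r, fermatProjector m α (2 * r) c ≠ 0) :
    FermatCharacter.Claim m r α := by
  rcases Nat.eq_zero_or_pos r with rfl | hr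
  · intro x _
    rw [algebraicClasses_zero]
    exact Submodule.mem_top
  obtain ⟨v, hv⟩ := hdim
  obtain ⟨c, hc, hne⟩ := hZ
  have hX : IsSmoothProjective (2 * r) (fermatHypersurface (2 * r) m) :=
    isSmoothProjective_fermatHypersurface (by omega) NeZero.one_le
  have hπmem : fermatProjector m α (2 * r) c ∈ fermatEigenspace m α (2 * r) := fermatProjector_mem α c
  have hπalg : fermatProjector m α (2 * r) c ∈ algebraicClasses (fermatHypersurface (2 * r) m) r :=
    eigenProjector_mem_algebraicClasses (fermatPolynomial ℂ (2 * r) m) (fermatGroup_le_diagonalStabilizer m)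
      (fermatCharacter m α) hX hc
  obtain ⟨t, ht⟩ := Submodule.mem_span_singleton.mp (hv hπmem)
  have ht0 : t ≠ 0 := by
    rintro rfl
    exact hne (by rw [← ht, zero_smul])
  have hvalg : v ∈ algebraicClasses (fermatHypersurface (2 * r) m) r := by
    have : v = t⁻¹ • fermatProjector m α (2 * r) c := by
      rw [← ht, smul_smul, inv_mul_cancel₀ ht0, one_smul]
    rw [this]
    exact Submodule.smul_mem _ _ hπalg
  intro x hx
  obtain ⟨s, hs⟩ := Submodule.mem_span_singleton.mp (hv hx)
  rw [← hs]
  exact Submodule.smul_mem _ _ hvalg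

namespace Aoki1987

/-! ### The `p`-standard character `σ_{p,a}` is admissible (Aoki §1, p. 387) -/

variable {m p r : ℕ}

/-- The coordinates of `σ ∼ σ_{p,a} = (a, a+d, …, a+(p-1)d, -pa)`: each is `a + kd` (`k < p`) or
`-pa`. [cite: Aoki1987, §1 p. 387 (definition of σ_{p,i})] -/
theorem pStandard_apply {a : ZMod m} {σ : Fin (2 * r + 2) → ZMod m}
    (hσ : univ.val.map σ =
      (Multiset.range p).map (fun k : ℕ => a + (k : ZMod m) * ((m / p : ℕ) : ZMod m)) +
        {-((p : ZMod m) * a)})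
    (i : Fin (2 * r + 2)) :
    (∃ k < p, σ i = a + (k : ZMod m) * ((m / p : ℕ) : ZMod m)) ∨ σ i = -((p : ZMod m) * a) := by
  have hi : σ i ∈ univ.val.map σ := Multiset.mem_map_of_mem σ (Finset.mem_univ_val i)
  rw [hσ, Multiset.mem_add, Multiset.mem_map, Multiset.mem_singleton] at hi
  rcases hi with ⟨k, hk, hki⟩ | h
  · exact Or.inl ⟨k, Multiset.mem_range.mp hk, hki.symm⟩
  · exact Or.inr h

/-- `(a, d) = 1` with `d > 2` (indeed `d > 1`) forces `d ∤ a`. [folklore] -/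
theorem not_dvd_val_of_coprime {a : ZMod m} (hd : 2 < m / p) (ha : Nat.Coprime a.val (m / p)) :
    ¬ m / p ∣ a.val := fun h ↦ by
  have := Nat.Coprime.eq_one_of_dvd ha.symm h
  omega

/-- **All coordinates of `σ_{p,a}` are non-zero** (`m = pd`, `(a, d) = 1`, `d > 2`): `a + kd = 0`
or `pa = 0` in `ℤ/m` would give `d ∣ a`. [cite: Aoki1987, §1 p. 387 (σ_{p,i} ∈ 𝔅 ⊂ 𝔄)] -/
theorem pStandard_ne_zero [NeZero m] (hp : p.Prime) (hpm : p ∣ m) (hd : 2 < m / p) {a : ZMod m}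
    (ha : Nat.Coprime a.val (m / p)) {σ : Fin (2 * r + 2) → ZMod m}
    (hσ : univ.val.map σ =
      (Multiset.range p).map (fun k : ℕ => a + (k : ZMod m) * ((m / p : ℕ) : ZMod m)) +
        {-((p : ZMod m) * a)})
    (i : Fin (2 * r + 2)) : σ i ≠ 0 := by
  have hnd := not_dvd_val_of_coprime hd ha
  have hdm : m / p ∣ m := Nat.div_dvd_of_dvd hpm
  have hmd : p * (m / p) = m := Nat.mul_div_cancel' hpm
  rcases pStandard_apply hσ i with ⟨k, -, hk⟩ | hk <;> rw [hk] <;> intro h0 <;> apply hnd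
  · have h1 : ((a.val + k * (m / p) : ℕ) : ZMod m) = 0 := by
      push_cast
      rw [ZMod.natCast_zmod_val]
      exact h0
    rw [ZMod.natCast_eq_zero_iff] at h1
    exact (Nat.dvd_add_left (dvd_mul_left _ _)).mp (hdm.trans h1)
  · have h1 : ((p * a.val : ℕ) : ZMod m) = 0 := by
      push_cast
      rw [ZMod.natCast_zmod_val]
      exact neg_eq_zero.mp h0
    rw [ZMod.natCast_eq_zero_iff] at h1
    exact Nat.dvd_of_mul_dvd_mul_left hp.pos (by rw [hmd]; exact h1)

/-- **`Σᵢ σᵢ = 0` for `σ ∼ σ_{p,a}`** (`p = 2r + 1`, `p ∣ m`): the sum is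
`pa + d·(0 + 1 + ⋯ + (p-1)) - pa = d p r = m r ≡ 0`. [cite: Aoki1987, §1 p. 387 (σ_{p,i} ∈ 𝔅 ⊂ 𝔄)] -/
theorem pStandard_sum_eq_zero [NeZero m] (hpr : p = 2 * r + 1) (hpm : p ∣ m) {a : ZMod m}
    {σ : Fin (2 * r + 2) → ZMod m}
    (hσ : univ.val.map σ =
      (Multiset.range p).map (fun k : ℕ => a + (k : ZMod m) * ((m / p : ℕ) : ZMod m)) +
        {-((p : ZMod m) * a)}) :
    ∑ i, σ i = 0 := by
  have hsum : ∑ i, σ i = (univ.val.map σ).sum := (Finset.sum_eq_multiset_sum _ _)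
  rw [hsum, hσ, Multiset.sum_add, Multiset.sum_singleton]
  have hrange : ((Multiset.range p).map
      (fun k : ℕ => a + (k : ZMod m) * ((m / p : ℕ) : ZMod m))).sum =
      ∑ k ∈ Finset.range p, (a + (k : ZMod m) * ((m / p : ℕ) : ZMod m)) := rfl
  rw [hrange, Finset.sum_add_distrib, Finset.sum_const, Finset.card_range, ← Finset.sum_mul,
    nsmul_eq_mul]
  have hgauss : ∑ k ∈ Finset.range p, k = p * r := by
    have h := Finset.sum_range_id_mul_two p
    subst hpr
    have h' : (2 * r + 1) * (2 * r + 1 - 1) = ((2 * r + 1) * r) * 2 := by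
      rw [Nat.add_sub_cancel]; ring
    rw [h'] at h
    exact Nat.eq_of_mul_eq_mul_right two_pos h
  have h2 : (∑ k ∈ Finset.range p, (k : ZMod m)) * ((m / p : ℕ) : ZMod m) = 0 := by
    rw [← Nat.cast_sum, hgauss, ← Nat.cast_mul, Nat.mul_right_comm, Nat.mul_div_cancel' hpm,
      Nat.cast_mul, ZMod.natCast_self, zero_mul]
  rw [h2]; ring

/-- **`σ_{p,a} ∈ 𝔄^{p-1}ₘ`**: all coordinates non-zero and sum zero, so `V(σ)` is one of the
eigenlines of the primitive middle cohomology of `X^{p-1}ₘ`.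
[cite: Aoki1987, §1 p. 387 (σ_{p,i} ∈ 𝔅^{p-1}ₘ)] -/
theorem isAdmissible_pStandard [NeZero m] (hp : p.Prime) (hpr : p = 2 * r + 1) (hpm : p ∣ m)
    (hd : 2 < m / p) {a : ZMod m} (ha : Nat.Coprime a.val (m / p)) {σ : Fin (2 * r + 2) → ZMod m}
    (hσ : univ.val.map σ =
      (Multiset.range p).map (fun k : ℕ => a + (k : ZMod m) * ((m / p : ℕ) : ZMod m)) +
        {-((p : ZMod m) * a)}) :
    FermatCharacter.IsAdmissible σ :=
  ⟨pStandard_ne_zero hp hpm hd ha hσ, pStandard_sum_eq_zero hpr hpm hσ⟩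

/-! ### Lemma 3-2 ⇒ (3.1)–(3.3): the equations of `Y` cut out the Fermat form (`Y ⊂ X^{p-1}ₘ`) -/

open MvPolynomial

section Newton

variable (τ : Type*) [Fintype τ] (R : Type*) [CommRing R]

/-- **The power sums `y₀ᵏ + ⋯ + y_{p-1}ᵏ`, `1 ≤ k ≤ r`, lie in the ideal `(e₁, …, e_r)`** of the
elementary symmetric polynomials (Newton's identities, by induction on `k`; the content of
Aoki's Lemma 3-2 for `l ≤ r`: every monomial `f₁^{e₁}⋯f_p^{e_p}` with `Σ i eᵢ = l ≤ r` has some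
`eᵢ > 0`, `i ≤ r`). [cite: Aoki1987, Lemma 3-2 (p. 390)] -/
theorem psum_mem_span_esymm (r : ℕ) :
    ∀ k, 0 < k → k ≤ r → psum τ R k ∈ Ideal.span ((fun j ↦ esymm τ R j) '' Set.Icc 1 r) := by
  intro k
  induction k using Nat.strong_induction_on with
  | _ k ih =>
    intro hk hkr
    rw [psum_eq_mul_esymm_sub_sum τ R k hk]
    refine Ideal.sub_mem _ (Ideal.mul_mem_left _ _ (Ideal.subset_span ⟨k, ⟨hk, hkr⟩, rfl⟩))
      (Ideal.sum_mem _ fun a ha ↦ ?_)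
    simp only [mem_filter, mem_antidiagonal, Set.mem_Ioo] at ha
    obtain ⟨hsum, h1, h2⟩ := ha
    exact Ideal.mul_mem_left _ _ (ih a.2 (by omega) (by omega) (by omega))

/-- **(3.1)–(3.2): `y₀ᵖ + ⋯ + y_{p-1}ᵖ - p·y₀⋯y_{p-1} ∈ (e₁, …, e_r)`** for `p = 2r + 1` variables
— Newton's identity in degree `p`: `p_p = p e_p - Σ_{0<i<p} (-1)ⁱ eᵢ p_{p-i}`, and in each term
either `i ≤ r` (so `eᵢ` is a generator) or `p - i ≤ r` (so `p_{p-i}` lies in the ideal); Aoki's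
`x₀ᵐ + ⋯ + x_{p-1}ᵐ = f₁g₁ + ⋯ + f_rg_r + p f_p`. [cite: Aoki1987, Lemma 3-2 and (3.1)–(3.2) (p. 390)] -/
theorem psum_sub_mul_esymm_mem_span_esymm (r : ℕ) :
    psum τ R (2 * r + 1) - ((2 * r + 1 : ℕ) : MvPolynomial τ R) * esymm τ R (2 * r + 1) ∈
      Ideal.span ((fun j ↦ esymm τ R j) '' Set.Icc 1 r) := by
  rw [psum_eq_mul_esymm_sub_sum τ R (2 * r + 1) (by omega)]
  have hsign : (-1 : MvPolynomial τ R) ^ (2 * r + 1 + 1) = 1 := by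
    rw [show 2 * r + 1 + 1 = 2 * (r + 1) by ring, pow_mul, neg_one_sq, one_pow]
  rw [hsign, one_mul, sub_sub_cancel_left]
  refine neg_mem (Ideal.sum_mem _ fun a ha ↦ ?_)
  simp only [mem_filter, mem_antidiagonal, Set.mem_Ioo] at ha
  obtain ⟨hsum, h1, h2⟩ := ha
  by_cases hle : a.1 ≤ r
  · exact Ideal.mul_mem_right _ _ (Ideal.mul_mem_left _ _ (Ideal.subset_span ⟨a.1, ⟨h1, hle⟩, rfl⟩))
  · exact Ideal.mul_mem_left _ _ (psum_mem_span_esymm τ R r a.2 (by omega) (by omega))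

/-- `e_n(y₁, …, y_n) = y₁ ⋯ y_n` (Aoki's `f_p = y₀⋯y_{p-1}`). [folklore] -/
theorem esymm_fin_self (n : ℕ) : esymm (Fin n) R n = ∏ i, X i := by
  have h : esymm (Fin n) R (Fintype.card (Fin n)) = ∏ i, X i := by
    rw [esymm, ← Finset.card_univ, Finset.powersetCard_self, Finset.sum_singleton]
  rwa [Fintype.card_fin] at h

end Newton

variable {R : Type*} [CommRing R]

/-- **Aoki's (3.3)**: in `R[x₀, …, x_p]`, `p = 2r + 1`, for `c ∈ R` with `cᵈ = -p`, the Fermat form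
`x₀^{pd} + ⋯ + x_p^{pd}` lies in the ideal generated by `f₀ = x_pᵖ - c·x₀⋯x_{p-1}` and
`e_k(x₀ᵈ, …, x_{p-1}ᵈ)`, `1 ≤ k ≤ r` — from (3.1)–(3.2) under `yᵢ ↦ xᵢᵈ` and
`x_p^{pd} + p·(x₀⋯x_{p-1})ᵈ = (x_pᵖ)ᵈ - (c x₀⋯x_{p-1})ᵈ ∈ (f₀)` (Aoki: `= ∏_{ζᵈ=1} f_{0,ζ}`). Here
`x_p` is the coordinate `Fin.last (2r+1)` and `x₀, …, x_{p-1}` are the `Fin.castSucc i`.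
[cite: Aoki1987, (3.3) (p. 390)] -/
theorem sum_X_pow_mem_idealY (r d : ℕ) (c : R) (hc : c ^ d = -((2 * r + 1 : ℕ) : R)) :
    (∑ i : Fin (2 * r + 2), (X i : MvPolynomial (Fin (2 * r + 2)) R) ^ ((2 * r + 1) * d)) ∈
      Ideal.span (insert
        (X (Fin.last (2 * r + 1)) ^ (2 * r + 1) - C c * ∏ i : Fin (2 * r + 1), X (Fin.castSucc i))
        ((fun j ↦ aeval (fun i : Fin (2 * r + 1) ↦
            (X (Fin.castSucc i) : MvPolynomial (Fin (2 * r + 2)) R) ^ d) (esymm (Fin (2 * r + 1)) R j)) ''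
          Set.Icc 1 r)) := by
  set p := 2 * r + 1 with hp
  set φ : MvPolynomial (Fin p) R →ₐ[R] MvPolynomial (Fin (p + 1)) R :=
    aeval (fun i : Fin p ↦ (X (Fin.castSucc i) : MvPolynomial (Fin (p + 1)) R) ^ d) with hφ
  set f0 : MvPolynomial (Fin (p + 1)) R := X (Fin.last p) ^ p - C c * ∏ i : Fin p, X (Fin.castSucc i)
    with hf0
  set I : Ideal (MvPolynomial (Fin p) R) := Ideal.span ((fun j ↦ esymm (Fin p) R j) '' Set.Icc 1 r)
    with hI
  set J : Ideal (MvPolynomial (Fin (p + 1)) R) :=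
    Ideal.span (insert f0 ((fun j ↦ φ (esymm (Fin p) R j)) '' Set.Icc 1 r)) with hJ
  -- (a) `φ : yᵢ ↦ xᵢᵈ` maps `I = (e₁, …, e_r)` into `J`
  have hIJ : I.map φ ≤ J := by
    rw [hI, Ideal.map_span]
    refine Ideal.span_mono ?_
    rintro _ ⟨_, ⟨j, hj, rfl⟩, rfl⟩
    exact Set.mem_insert_of_mem _ ⟨j, hj, rfl⟩
  -- (b) `Σ_{i<p} xᵢ^{pd} - p ∏ xᵢᵈ = φ (p_p - p e_p) ∈ J`
  have hb : (∑ i : Fin p, (X (Fin.castSucc i) : MvPolynomial (Fin (p + 1)) R) ^ (p * d)) -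
      (p : MvPolynomial (Fin (p + 1)) R) * ∏ i : Fin p, X (Fin.castSucc i) ^ d ∈ J := by
    have hmem : φ (psum (Fin p) R p - (p : MvPolynomial (Fin p) R) * esymm (Fin p) R p) ∈ J :=
      hIJ (Ideal.mem_map_of_mem φ (psum_sub_mul_esymm_mem_span_esymm (Fin p) R r))
    have hφ' : φ (psum (Fin p) R p - (p : MvPolynomial (Fin p) R) * esymm (Fin p) R p) =
        (∑ i : Fin p, (X (Fin.castSucc i) : MvPolynomial (Fin (p + 1)) R) ^ (p * d)) -
          (p : MvPolynomial (Fin (p + 1)) R) * ∏ i : Fin p, X (Fin.castSucc i) ^ d := by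
      rw [map_sub, map_mul, map_natCast, psum, map_sum, esymm_fin_self, map_prod]
      simp only [hφ, map_pow, aeval_X, ← pow_mul, mul_comm d p]
    rwa [hφ'] at hmem
  -- (c) `x_p^{pd} + p ∏ xᵢᵈ = (x_pᵖ)ᵈ - (c ∏ xᵢ)ᵈ ∈ (f₀)`
  have hc' : (X (Fin.last p) : MvPolynomial (Fin (p + 1)) R) ^ (p * d) +
      (p : MvPolynomial (Fin (p + 1)) R) * ∏ i : Fin p, X (Fin.castSucc i) ^ d ∈ J := by
    obtain ⟨q, hq⟩ := sub_dvd_pow_sub_pow ((X (Fin.last p) : MvPolynomial (Fin (p + 1)) R) ^ p)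
      (C c * ∏ i : Fin p, X (Fin.castSucc i)) d
    have heq : ((X (Fin.last p) : MvPolynomial (Fin (p + 1)) R) ^ p) ^ d -
        (C c * ∏ i : Fin p, X (Fin.castSucc i)) ^ d =
        X (Fin.last p) ^ (p * d) + (p : MvPolynomial (Fin (p + 1)) R) * ∏ i : Fin p, X (Fin.castSucc i) ^ d := by
      rw [← pow_mul, mul_pow, ← map_pow, hc, Finset.prod_pow, map_neg, map_natCast]
      ring
    rw [← heq, hq]
    exact Ideal.mul_mem_right _ _ (Ideal.subset_span (Set.mem_insert _ _))
  -- (d) assemble: `Σ_{i ≤ p} xᵢ^{pd} = (Σ_{i<p} xᵢ^{pd} - p ∏ xᵢᵈ) + (x_p^{pd} + p ∏ xᵢᵈ)`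
  have h := Ideal.add_mem _ hb hc'
  rw [Fin.sum_univ_castSucc]
  convert h using 1
  ring

/-- **Prop. 3-1 (i): `Y ⊂ X^{p-1}ₘ`.** For `m = pd`, `p = 2r + 1`, and `c ∈ ℂ` with `cᵈ = -p`
(Aoki's `c = εᵖ ᵈ√p`), the Fermat form `fermatPolynomial ℂ (2r) m = x₀ᵐ + ⋯ + x_pᵐ` defining
`X^{p-1}ₘ = fermatHypersurface (p-1) m` lies in the homogeneous ideal of the equations of `Y`,
`f₀ = x_pᵖ - c·x₀⋯x_{p-1}` and `f_k = e_k(x₀ᵈ, …, x_{p-1}ᵈ)`, `1 ≤ k ≤ r` ("Since `Y` is defined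
by the equations `f₀ = ⋯ = f_r = 0`, (3.3) shows that `Y` is a subvariety of `X`").
[cite: Aoki1987, Prop. 3-1 (i) and (3.3) (pp. 389–390)] -/
theorem fermatPolynomial_mem_idealY {m : ℕ} (r d : ℕ) (hm : m = (2 * r + 1) * d) (c : ℂ)
    (hc : c ^ d = -((2 * r + 1 : ℕ) : ℂ)) :
    fermatPolynomial ℂ (2 * r) m ∈
      Ideal.span (insert
        (X (Fin.last (2 * r + 1)) ^ (2 * r + 1) - C c * ∏ i : Fin (2 * r + 1), X (Fin.castSucc i))
        ((fun j ↦ aeval (fun i : Fin (2 * r + 1) ↦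
            (X (Fin.castSucc i) : MvPolynomial (Fin (2 * r + 2)) ℂ) ^ d) (esymm (Fin (2 * r + 1)) ℂ j)) ''
          Set.Icc 1 r)) := by
  subst hm
  exact sum_X_pow_mem_idealY r d c hc

/-- The constant of `f₀` exists: some `c ∈ ℂ` has `cᵈ = -p` (`d ≥ 1`; Aoki takes
`c = εᵖ ᵈ√p`, `ε = exp(π√-1/m)`, `εᵐ = -1`). [cite: Aoki1987, §3 notation (p. 389)] -/
theorem exists_pow_eq_neg_natCast (p d : ℕ) (hd : 0 < d) : ∃ c : ℂ, c ^ d = -(p : ℂ) :=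
  IsAlgClosed.exists_pow_nat_eq _ hd

end Aoki1987

/-! ### The assembly: the named fact from the two remaining inputs -/

/-- **`Aoki1987_claim_pStandard` from the eigenspace structure and Thm. 2-1 proper.** Granted, on
the tree's carriers, (I) `hE1`: for `r > 0` and `α ∈ 𝔄²ʳₘ` (all `αᵢ ≠ 0`, `Σ αᵢ = 0`) the
eigenspace `V(α) ⊆ H²ʳ(X²ʳₘ(ℂ); ℂ)` is at most a line ("`dim V(α) = 1`", p. 385; Ran Prop. 1.7
(i)), and (II) `hY`: for `σ ∼ σ_{p,a}` as in the fact, some class in the span of the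
codimension-`r` cycle classes of `X^{p-1}ₘ` has `π_σ c ≠ 0` (Thm. 2-1: the subvariety `Y` of
(2.1) represents `σ`, `ω_σ(Y)·\overline{ω_σ(Y)} = (-1)ʳ p^{p-2} mᵖ ≠ 0`), the fact holds: `σ` is
admissible (`Aoki1987.isAdmissible_pStandard`), `r ≥ 1` (`p = 2r + 1` is prime), and
`FermatCharacter.claim_of_represents` applies.
[cite: Aoki1987, Thm. 2-1 (p. 388), p. 385 (dim V(α) = 1), p. 386 (represents ⟹ claim)]
[cite: Ran1980, §1 Prop. 1.7 (i)] -/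
theorem Aoki1987_claim_pStandard_of_represents
    (hE1 : ∀ (m r : ℕ) [NeZero m] (α : Fin (2 * r + 2) → ZMod m), 0 < r →
      FermatCharacter.IsAdmissible α → ∃ v, fermatEigenspace m α (2 * r) ≤ ℂ ∙ v)
    (hY : ∀ (m p r : ℕ) [NeZero m], p.Prime → p = 2 * r + 1 → p ∣ m → 2 < m / p →
      ∀ a : ZMod m, Nat.Coprime a.val (m / p) → ∀ σ : Fin (2 * r + 2) → ZMod m,
        univ.val.map σ =
          (Multiset.range p).map (fun k : ℕ => a + (k : ZMod m) * ((m / p : ℕ) : ZMod m)) +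
            {-((p : ZMod m) * a)} →
        ∃ c ∈ algebraicClasses (fermatHypersurface (2 * r) m) r, fermatProjector m σ (2 * r) c ≠ 0) :
    Aoki1987_claim_pStandard := by
  intro m p r _ hp hpr hpm hd a ha σ hσ
  have hr : 0 < r := by
    rcases Nat.eq_zero_or_pos r with rfl | h
    · have h1 : p = 1 := by omega
      exact absurd (h1 ▸ hp) Nat.not_prime_one
    · exact h
  exact FermatCharacter.claim_of_represents
    (hE1 m r σ hr (Aoki1987.isAdmissible_pStandard hp hpr hpm hd ha hσ))
    (hY m p r hp hpr hpm hd a ha σ hσ)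

/-! ### The `p`-standard character is a Hodge character: `σ_{p,a} ∈ 𝔅^{p-1}ₘ` (Aoki §1, p. 387) -/

namespace Aoki1987

variable {m p r : ℕ}

/-- Reindexing a sum over a complete residue system modulo `p` by an affine bijection
`k ↦ (c + u k) mod p`, `(u, p) = 1`. [folklore] -/
theorem sum_range_affine_mod {M : Type*} [AddCommMonoid M] (p c u : ℕ) (hp : 0 < p)
    (hu : Nat.Coprime u p) (g : ℕ → M) :
    ∑ k ∈ Finset.range p, g ((c + u * k) % p) = ∑ k ∈ Finset.range p, g k := by
  classical
  have hinj : Set.InjOn (fun k ↦ (c + u * k) % p) (Finset.range p) := by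
    intro k₁ hk₁ k₂ hk₂ h
    have h1 : c + u * k₁ ≡ c + u * k₂ [MOD p] := h
    have h2 : u * k₁ ≡ u * k₂ [MOD p] := Nat.ModEq.add_left_cancel' c h1
    have h3 : k₁ ≡ k₂ [MOD p] := Nat.ModEq.cancel_left_of_coprime hu.symm h2
    exact Nat.ModEq.eq_of_lt_of_lt h3 (Finset.mem_range.mp hk₁) (Finset.mem_range.mp hk₂)
  have himg : (Finset.range p).image (fun k ↦ (c + u * k) % p) = Finset.range p := by
    apply Finset.eq_of_subset_of_card_le
    · intro x hx
      obtain ⟨k, -, rfl⟩ := Finset.mem_image.mp hx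
      exact Finset.mem_range.mpr (Nat.mod_lt _ hp)
    · rw [Finset.card_image_of_injOn hinj]
  rw [← Finset.sum_image hinj, himg]

/-- **The representatives of `b, b + d, …` in `[0, m)`, `m = pd`**: writing `⟨b⟩ = b₀ + j₀ d` with
`0 ≤ b₀ < d`, one has `⟨b + n d⟩ = b₀ + ((j₀ + n) mod p)·d`. [folklore] -/
theorem val_add_natCast_mul [NeZero m] {d : ℕ} (hmd : p * d = m) (b : ZMod m) (n : ℕ) :
    (b + (n : ZMod m) * (d : ZMod m)).val = b.val % d + ((b.val / d + n) % p) * d := by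
  have hp : 0 < p := Nat.pos_of_ne_zero fun h ↦ NeZero.ne m (by rw [← hmd, h, zero_mul])
  have hd : 0 < d := Nat.pos_of_ne_zero fun h ↦ NeZero.ne m (by rw [← hmd, h, mul_zero])
  have h1 : b + (n : ZMod m) * (d : ZMod m) = ((b.val + n * d : ℕ) : ZMod m) := by
    push_cast
    rw [ZMod.natCast_zmod_val]
  rw [h1, ZMod.val_natCast]
  generalize b.val = B
  have hA : B % d + d * (B / d) = B := Nat.mod_add_div _ _
  have hS : (B / d + n) % p + p * ((B / d + n) / p) = B / d + n := Nat.mod_add_div _ _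
  have hlt : B % d + ((B / d + n) % p) * d < m := by
    have h1 : B % d < d := Nat.mod_lt _ hd
    have h2 : (B / d + n) % p + 1 ≤ p := Nat.mod_lt _ hp
    have h3 : ((B / d + n) % p + 1) * d ≤ p * d := Nat.mul_le_mul_right d h2
    rw [add_mul, one_mul, hmd] at h3
    omega
  have key : B + n * d = B % d + ((B / d + n) % p) * d + m * ((B / d + n) / p) := by
    rw [← hmd]
    have h4 : B % d + ((B / d + n) % p) * d + p * d * ((B / d + n) / p) =
        B % d + d * ((B / d + n) % p + p * ((B / d + n) / p)) := by ring
    rw [h4, hS]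
    conv_lhs => rw [← hA]
    ring
  rw [key, Nat.add_mul_mod_self_left, Nat.mod_eq_of_lt hlt]

/-- `⟨p b⟩ = p b₀` for `m = pd`, `⟨b⟩ = b₀ + j₀ d`, `0 ≤ b₀ < d`. [folklore] -/
theorem val_natCast_mul [NeZero m] {d : ℕ} (hmd : p * d = m) (b : ZMod m) :
    ((p : ZMod m) * b).val = p * (b.val % d) := by
  have hp : 0 < p := Nat.pos_of_ne_zero fun h ↦ NeZero.ne m (by rw [← hmd, h, zero_mul])
  have hd : 0 < d := Nat.pos_of_ne_zero fun h ↦ NeZero.ne m (by rw [← hmd, h, mul_zero])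
  have h1 : (p : ZMod m) * b = ((p * b.val : ℕ) : ZMod m) := by
    push_cast
    rw [ZMod.natCast_zmod_val]
  rw [h1, ZMod.val_natCast]
  generalize b.val = B
  have hA : B % d + d * (B / d) = B := Nat.mod_add_div _ _
  have key : p * B = p * (B % d) + m * (B / d) := by
    rw [← hmd]
    conv_lhs => rw [← hA]
    ring
  have hlt : p * (B % d) < m :=
    (Nat.mul_lt_mul_of_pos_left (Nat.mod_lt _ hd) hp).trans_eq hmd
  rw [key, Nat.add_mul_mod_self_left, Nat.mod_eq_of_lt hlt]

/-- `0 + 1 + ⋯ + (p - 1) = p r` for `p = 2r + 1`. [folklore] -/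
theorem sum_range_eq (hpr : p = 2 * r + 1) : ∑ k ∈ Finset.range p, k = p * r := by
  have h := Finset.sum_range_id_mul_two p
  subst hpr
  have h' : (2 * r + 1) * (2 * r + 1 - 1) = ((2 * r + 1) * r) * 2 := by
    rw [Nat.add_sub_cancel]; ring
  rw [h'] at h
  exact Nat.eq_of_mul_eq_mul_right two_pos h

/-- **The `p`-standard elements are Hodge characters: `σ_{p,a} ∈ 𝔅^{p-1}ₘ`** (Aoki p. 387: "These
elements belong to … `𝔅^{p-1}ₘ`", from Aoki, Math. Ann. 266 (1983)). For `m = pd`, `p = 2r + 1`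
prime, `d > 2`, `(a, d) = 1` and `σ ∼ (a, a+d, …, a+(p-1)d, -pa)`: `σ` is admissible and for
every unit `t ∈ (ℤ/m)ˣ`, `2 |tσ| = 2r + 2`, i.e. `2 Σᵢ ⟨t σᵢ⟩ = m (2r + 2)`. Proof: with
`b = ta`, `⟨b⟩ = b₀ + j₀ d` (`0 < b₀ < d` as `d ∤ ta`), the representatives of `t(a + kd) = b + (tk) d`,
`k < p`, are `b₀ + ((j₀ + ⟨t⟩k) mod p) d`, a permutation of `b₀, b₀ + d, …, b₀ + (p-1)d` (`t` is a
unit mod `p`), summing to `p b₀ + d·p(p-1)/2 = p b₀ + m r`; and `⟨-p b⟩ = m - p b₀`; total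
`m (r + 1)`. [cite: Aoki1987, §1 p. 387 (σ_{p,i} ∈ 𝔅^{p-1}ₘ)] -/
theorem isHodge_pStandard [NeZero m] (hp : p.Prime) (hpr : p = 2 * r + 1) (hpm : p ∣ m)
    (hd : 2 < m / p) {a : ZMod m} (ha : Nat.Coprime a.val (m / p)) {σ : Fin (2 * r + 2) → ZMod m}
    (hσ : univ.val.map σ =
      (Multiset.range p).map (fun k : ℕ => a + (k : ZMod m) * ((m / p : ℕ) : ZMod m)) +
        {-((p : ZMod m) * a)}) :
    FermatCharacter.IsHodge σ := by
  refine ⟨isAdmissible_pStandard hp hpr hpm hd ha hσ, fun t ↦ ?_⟩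
  set d := m / p with hd_def
  have hmd : p * d = m := Nat.mul_div_cancel' hpm
  have hp0 : 0 < p := hp.pos
  have hd0 : 0 < d := by omega
  have hdm : d ∣ m := Dvd.intro_left p hmd
  set b : ZMod m := (t : ZMod m) * a with hb_def
  have htcop : Nat.Coprime (t : ZMod m).val m := ZMod.val_coe_unit_coprime t
  -- `b₀ = ⟨ta⟩ mod d ≠ 0`
  have hb0 : b.val % d ≠ 0 := by
    intro h0
    have hdvd : d ∣ b.val := Nat.dvd_of_mod_eq_zero h0
    rw [hb_def, ZMod.val_mul] at hdvd
    have h2 : d ∣ (t : ZMod m).val * a.val := (Nat.dvd_mod_iff hdm).mp hdvd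
    have h3 : Nat.Coprime d (t : ZMod m).val := (Nat.Coprime.coprime_dvd_right hdm htcop).symm
    exact not_dvd_val_of_coprime hd ha (h3.dvd_of_dvd_mul_left h2)
  have hpb : (p : ZMod m) * b ≠ 0 := by
    intro h0
    have h1 := congrArg ZMod.val h0
    rw [val_natCast_mul hmd, ZMod.val_zero] at h1
    exact hb0 ((Nat.mul_eq_zero.mp h1).resolve_left hp0.ne')
  -- `normSum` as a multiset sum over the values of `σ`
  have hns : FermatCharacter.normSum (fun i ↦ (t : ZMod m) * σ i) =
      ((univ.val.map σ).map fun x ↦ ((t : ZMod m) * x).val).sum := by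
    show ∑ i, ((t : ZMod m) * σ i).val = _
    rw [Finset.sum_eq_multiset_sum, Multiset.map_map]
    rfl
  rw [hns, hσ, Multiset.map_add, Multiset.sum_add, Multiset.map_singleton, Multiset.sum_singleton,
    Multiset.map_map]
  have hrange : ((Multiset.range p).map ((fun x ↦ ((t : ZMod m) * x).val) ∘
      fun k : ℕ ↦ a + (k : ZMod m) * (d : ZMod m))).sum =
      ∑ k ∈ Finset.range p, ((t : ZMod m) * (a + (k : ZMod m) * (d : ZMod m))).val := rfl
  rw [hrange]
  -- the `p` terms `⟨t(a + kd)⟩ = b₀ + ((j₀ + ⟨t⟩ k) mod p) d`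
  have hterm : ∀ k : ℕ, ((t : ZMod m) * (a + (k : ZMod m) * (d : ZMod m))).val =
      b.val % d + ((b.val / d + (t : ZMod m).val * k) % p) * d := by
    intro k
    have h1 : (t : ZMod m) * (a + (k : ZMod m) * (d : ZMod m)) =
        b + (((t : ZMod m).val * k : ℕ) : ZMod m) * (d : ZMod m) := by
      push_cast
      rw [ZMod.natCast_zmod_val, hb_def]
      ring
    rw [h1, val_add_natCast_mul hmd]
  simp_rw [hterm]
  rw [Finset.sum_add_distrib, Finset.sum_const, Finset.card_range, smul_eq_mul, ← Finset.sum_mul]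
  have hperm := sum_range_affine_mod p (b.val / d) (t : ZMod m).val hp0
    (Nat.Coprime.coprime_dvd_right hpm htcop) (fun k ↦ k)
  rw [hperm, sum_range_eq hpr]
  -- the last term `⟨t · (-pa)⟩ = ⟨-p b⟩ = m - p b₀`
  have hlast : ((t : ZMod m) * -((p : ZMod m) * a)).val = m - p * (b.val % d) := by
    have h1 : (t : ZMod m) * -((p : ZMod m) * a) = -((p : ZMod m) * b) := by rw [hb_def]; ring
    rw [h1, ZMod.neg_val, if_neg hpb, val_natCast_mul hmd]
  rw [hlast]
  have hB : p * (b.val % d) ≤ m :=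
    ((Nat.mul_lt_mul_of_pos_left (Nat.mod_lt _ hd0) hp0).trans_eq hmd).le
  zify [hB]
  have hmd' : ((p : ℕ) : ℤ) * d = m := by exact_mod_cast hmd
  linear_combination (2 * (r : ℤ)) * hmd'

/-! ### `Y ⊆ X^{p-1}ₘ` in `ℙᵖ = Proj ℂ[x₀, …, x_p]` (Prop. 3-1 (i), set-theoretically) -/

section ZeroLocus

open MvPolynomial

/-- **Prop. 3-1 (i), on the points of `ℙᵖ_ℂ = Proj ℂ[x₀, …, x_p]`**: the projective zero locus of
the equations of `Y` — `f₀ = x_pᵖ - c·x₀⋯x_{p-1}` (`cᵈ = -p`) and `e_k(x₀ᵈ, …, x_{p-1}ᵈ)`,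
`1 ≤ k ≤ r` — is contained in the zero locus `V₊(x₀ᵐ + ⋯ + x_pᵐ)` of the Fermat form, `m = pd`,
`p = 2r + 1`, i.e. in the underlying set of `X^{p-1}ₘ` (`Motives.IsHypersurfaceCutOutBy`,
`fermatHypersurface (p - 1) m`; `ℙᵖ` graded by degree as there, `MvPolynomial.gradedAlgebra`):
the Fermat form lies in the ideal of the equations (`fermatPolynomial_mem_idealY`).
[cite: Aoki1987, Prop. 3-1 (i) (pp. 389–390)] -/
theorem zeroLocus_idealY_subset {m : ℕ} (r d : ℕ) (hm : m = (2 * r + 1) * d) (c : ℂ)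
    (hc : c ^ d = -((2 * r + 1 : ℕ) : ℂ)) :
    letI := MvPolynomial.gradedAlgebra (σ := Fin (2 * r + 2)) (R := ℂ)
    ProjectiveSpectrum.zeroLocus (MvPolynomial.homogeneousSubmodule (Fin (2 * r + 2)) ℂ)
        (insert
          (X (Fin.last (2 * r + 1)) ^ (2 * r + 1) - C c * ∏ i : Fin (2 * r + 1), X (Fin.castSucc i))
          ((fun j ↦ aeval (fun i : Fin (2 * r + 1) ↦
              (X (Fin.castSucc i) : MvPolynomial (Fin (2 * r + 2)) ℂ) ^ d) (esymm (Fin (2 * r + 1)) ℂ j)) ''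
            Set.Icc 1 r)) ⊆
      ProjectiveSpectrum.zeroLocus (MvPolynomial.homogeneousSubmodule (Fin (2 * r + 2)) ℂ)
        {fermatPolynomial ℂ (2 * r) m} := by
  letI := MvPolynomial.gradedAlgebra (σ := Fin (2 * r + 2)) (R := ℂ)
  rw [← ProjectiveSpectrum.zeroLocus_span _ (insert _ _)]
  exact ProjectiveSpectrum.zeroLocus_anti_mono _
    (Set.singleton_subset_iff.mpr (fermatPolynomial_mem_idealY r d hm c hc))

end ZeroLocus

end Aoki1987

end Literature.AlgebraicGeometry.HodgeTheory

end
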